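import Mathlib
import Literature.ModelTheory.ExponentialFields.SemialgebraicInterior
import Summits.KontsevichZagierPeriods.KontsevichZagierPeriods.Theorems.InverseLandauTateFamilyKernelStubGpDensity

/-!
# Crux `TateFamilyKernel` (stmt-KontsevichZagierPeriods-9130), line `Sketch`: `stub_gvDensity`

Step GV2 (PUSHFORWARD DENSITY, TOP INTERVAL) of the linear-slope graph-pencil class
`Q = 1 − ϖ(u(z₂) + v(z₂)z₁)`, `u, v ∈ ℚ[s]`, `v > 0` on `[0,1]`, `u + v` strictly increasing on
`[0,1]`, numerator `P ∈ ℚ[z₁,z₂]` arbitrary, in the lead's skeleton for the crux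
`Summit.KontsevichZagierPeriods.KontsevichZagierPeriods.Theses.InverseLandau.TateFamilyKernel`.
It is the graph-pencil step GP2 (`…StubGpDensity`, constant slope `β`) with the constant slope
replaced by a polynomial slope `v(z₂) > 0`.

Write `U = u(·)`, `V = v(·)`, `W = U + V` (real polynomial functions),
`T(z) = U(z₂) + V(z₂)z₁` on `(0,1)²` and `ψ(y,σ) = P((y − U(σ))/V(σ), σ)/V(σ)`.  If every
polynomial test function of `T` integrates to zero against `P` on the open unit square, then for
every `s ∈ (0,1)` with `U < W(s)` on `[0,1]` the single-branch identity
`∫_{σ ∈ (s,1)} ψ(W(s), σ) dσ = 0` holds.  Unlike GP2, `U` need not be monotone, so the density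
`Φ(y) = ∫_{σ ∈ (0,1)} 𝟙[U(σ) < y < W(σ)] ψ(y,σ) dσ` of `T_*(P dz)` may jump (at a constant
value of `U`); the proof therefore uses continuity only on the TOP INTERVAL `J = (max U, W(1))`:

1. polynomial test functions upgrade to continuous ones (Weierstrass on the bounded range of `T`
   and a bound for `P` on the closed square, `GvDensity.setIntegral_comp_mul_aeval_eq_zero`);
2. transport to `ℝ × ℝ` (`LinDensity.setIntegral_pi_Ioo_fin_two`,
   `LinDensity.setIntegral_Ioo_prod_Ioo_symm`), substitute `y = U(σ) + V(σ)z₁` at fixed `σ`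
   (`GpDensity.setIntegral_Ioo_unit_comp_affine`) and swap
   (`LinDensity.setIntegral_setIntegral_swap`): `∫_□ φ(T) P = ∫ φ(y) Φ(y) dy` for continuous `φ`;
3. for `y > max_{[0,1]} U` the constraint `U(σ) < y` is void and `y < W(σ) ⟺ σ > e(y)` (`e` the
   clamped inverse of `W|[0,1]`, `GpDensity.exists_extendedInverse`), so there
   `Φ(y) = Φₜ(y) := ∫_{e(y)}^{1} ψ(y,σ) dσ`, a continuous function of `y ∈ ℝ` (the slope is
   regularised to `V ∘ projIcc 0 1 > 0` so that `ψ` is continuous on all of `ℝ²`);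
4. `Φₜ` is then orthogonal to every smooth function supported in `J`, hence zero a.e. on `J`
   (`IsOpen.ae_eq_zero_of_integral_contDiff_smul_eq_zero`), hence zero on `J` by continuity
   (`MeasureTheory.Measure.eqOn_open_of_ae_eq`);
5. at `y = W(s) ∈ J` one has `e(y) = s`, whence the claim.

References: Kontsevich–Zagier 2001, §1.2 (an elementary real-analysis step of one test class of
the period conjecture).  Mathlib plus
`Literature.ModelTheory.ExponentialFields.continuous_aeval_real` and the landed `LinDensity` /
`GpDensity` helpers; no named fact, no new definition.  Helpers live in the sub-namespace
`GvDensity`.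
-/

noncomputable section

open MeasureTheory Set MvPolynomial
open Literature.ModelTheory.ExponentialFields (continuous_aeval_real)

namespace Summit.KontsevichZagierPeriods.InverseLandau.TateFamilyKernel.Descent

namespace GvDensity

/-- **Continuous test functions from polynomial ones.** If `T` is continuous with
`T((0,1)²) ⊆ [A, B]` and `∫_{(0,1)²} g(T)·P = 0` for every real polynomial `g`, then
`∫_{(0,1)²} φ(T)·P = 0` for every continuous `φ : ℝ → ℝ`: approximate `φ` uniformly on `[A, B]`
by polynomials (Weierstrass, `exists_polynomial_near_of_continuousOn`) and bound `P` on the closed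
square, whose open part has volume `1`. [folklore] -/
theorem setIntegral_comp_mul_aeval_eq_zero (P : MvPolynomial (Fin 2) ℚ) {T : (Fin 2 → ℝ) → ℝ}
    (hT : Continuous T) {A B : ℝ}
    (hTAB : ∀ z ∈ Set.pi Set.univ (fun _ : Fin 2 => Ioo (0 : ℝ) 1), T z ∈ Icc A B)
    (htest : ∀ g : Polynomial ℝ,
      ∫ z in Set.pi Set.univ (fun _ : Fin 2 => Ioo (0 : ℝ) 1), g.eval (T z) * aeval z P = 0)
    {φ : ℝ → ℝ} (hφ : Continuous φ) :
    ∫ z in Set.pi Set.univ (fun _ : Fin 2 => Ioo (0 : ℝ) 1), φ (T z) * aeval z P = 0 := by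
  have hcl : IsCompact (Set.pi Set.univ fun _ : Fin 2 => Icc (0 : ℝ) 1) :=
    isCompact_univ_pi fun _ => isCompact_Icc
  have hsub : (Set.pi Set.univ fun _ : Fin 2 => Ioo (0 : ℝ) 1) ⊆
      Set.pi Set.univ fun _ : Fin 2 => Icc (0 : ℝ) 1 :=
    Set.pi_mono fun _ _ => Ioo_subset_Icc_self
  obtain ⟨K, hK⟩ := hcl.exists_bound_of_continuousOn (continuous_aeval_real P).continuousOn
  have hK0 : 0 ≤ K := (norm_nonneg _).trans (hK 0 (by simp [Pi.le_def]))
  have hK1 : 0 < K + 1 := by linarith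
  have hvol : volume (Set.pi Set.univ fun _ : Fin 2 => Ioo (0 : ℝ) 1) < ⊤ :=
    (measure_mono hsub).trans_lt hcl.measure_lt_top
  have hvol1 : volume.real (Set.pi Set.univ fun _ : Fin 2 => Ioo (0 : ℝ) 1) = 1 := by
    rw [measureReal_def,
      Real.volume_pi_Ioo_toReal (a := fun _ => 0) (b := fun _ => 1) fun _ => zero_le_one]
    simp
  have hint : ∀ θ : ℝ → ℝ, Continuous θ → IntegrableOn (fun z => θ (T z) * aeval z P)
      (Set.pi Set.univ fun _ : Fin 2 => Ioo (0 : ℝ) 1) := fun θ hθ =>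
    (((hθ.comp hT).mul (continuous_aeval_real P)).continuousOn.integrableOn_compact hcl).mono_set
      hsub
  refine abs_eq_zero.1 (le_antisymm (le_of_forall_pos_le_add fun δ hδ => ?_) (abs_nonneg _))
  obtain ⟨p, hp⟩ := exists_polynomial_near_of_continuousOn A B φ hφ.continuousOn (δ / (K + 1))
    (div_pos hδ hK1)
  have hsplit : ∫ z in Set.pi Set.univ (fun _ : Fin 2 => Ioo (0 : ℝ) 1), φ (T z) * aeval z P =
      ∫ z in Set.pi Set.univ (fun _ : Fin 2 => Ioo (0 : ℝ) 1),
        (φ (T z) - p.eval (T z)) * aeval z P := by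
    simp_rw [sub_mul]
    rw [integral_sub (hint φ hφ) (hint _ p.continuous), htest p, sub_zero]
  rw [hsplit, zero_add]
  calc |∫ z in Set.pi Set.univ (fun _ : Fin 2 => Ioo (0 : ℝ) 1),
        (φ (T z) - p.eval (T z)) * aeval z P|
      = ‖∫ z in Set.pi Set.univ (fun _ : Fin 2 => Ioo (0 : ℝ) 1),
          (φ (T z) - p.eval (T z)) * aeval z P‖ := (Real.norm_eq_abs _).symm
    _ ≤ δ / (K + 1) * K * volume.real (Set.pi Set.univ fun _ : Fin 2 => Ioo (0 : ℝ) 1) := by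
        refine norm_setIntegral_le_of_norm_le_const hvol fun z hz => ?_
        rw [norm_mul]
        refine mul_le_mul ?_ (hK z (hsub hz)) (norm_nonneg _) (div_pos hδ hK1).le
        rw [Real.norm_eq_abs, abs_sub_comm]
        exact (hp (T z) (hTAB z hz)).le
    _ = δ * (K / (K + 1)) := by rw [hvol1]; ring
    _ ≤ δ * 1 := by gcongr; rw [div_le_one hK1]; linarith
    _ = δ := mul_one δ

end GvDensity

open LinDensity GpDensity GvDensity in
/-- **Stub `stub_gvDensity`** (linear-slope graph-pencil class `Q = 1 − ϖ(u(z₂) + v(z₂)z₁)`,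
step GV2: PUSHFORWARD DENSITY on the TOP INTERVAL).  Let `u, v ∈ ℚ[s]` with real polynomial
functions `U, V`, `V > 0` on `[0,1]`, `W = U + V` strictly increasing on `[0,1]`, and suppose
every polynomial test function of `T(z) = U(z₂) + V(z₂)z₁` integrates to zero against `P` on
`(0,1)²`.  Then for every `s ∈ (0,1)` with `U < W(s)` on `[0,1]`,
`∫_{σ ∈ (s,1)} P((W(s) − U(σ))/V(σ), σ)/V(σ) dσ = 0`.  Indeed (Weierstrass on the range of `T`)
continuous test functions `φ` integrate to zero as well, and `∫_□ φ(T) P = ∫ φ Φ` with the density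
`Φ(y) = ∫_{σ ∈ (0,1)} 𝟙[U σ < y < W σ] ψ(y,σ) dσ`, `ψ(y,σ) = P((y − U σ)/V σ, σ)/V σ` (affine
substitution `y = U(σ) + V(σ)z₁` at fixed `σ`, then Fubini); on `J = (max_{[0,1]} U, W(1))` the
density equals the continuous `Φₜ(y) = ∫_{e(y)}^{1} ψ(y,σ) dσ` (`e` the clamped inverse of
`W|[0,1]`, `GpDensity.exists_extendedInverse`), which is orthogonal to all smooth functions
supported in `J`, hence zero a.e. on `J`, hence zero on `J`; at `y = W(s) ∈ J`, `e(y) = s`.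
[cite: KontsevichZagier2001, §1.2] -/
theorem stub_gvDensity (u v : Polynomial ℚ) (P : MvPolynomial (Fin 2) ℚ)
    (hv0 : ∀ s ∈ Icc (0 : ℝ) 1, 0 < Polynomial.aeval s v)
    (hmono : StrictMonoOn (fun s : ℝ => Polynomial.aeval s u + Polynomial.aeval s v) (Icc (0 : ℝ) 1))
    (htest : ∀ g : Polynomial ℝ, ∫ z in Set.pi Set.univ (fun _ : Fin 2 => Ioo (0 : ℝ) 1),
      g.eval (Polynomial.aeval (z 1) u + Polynomial.aeval (z 1) v * z 0) * aeval z P = 0) :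
    ∀ s ∈ Ioo (0 : ℝ) 1, (∀ σ ∈ Icc (0 : ℝ) 1, Polynomial.aeval σ u < Polynomial.aeval s u + Polynomial.aeval s v) →
      ∫ σ in Ioo s 1, aeval (![(Polynomial.aeval s u + Polynomial.aeval s v - Polynomial.aeval σ u) /
          Polynomial.aeval σ v, σ] : Fin 2 → ℝ) P / Polynomial.aeval σ v = 0 := by
  -- the real polynomial functions `U = u(·)`, `V = v(·)`; `W = U + V` and its clamped inverse `e`
  obtain ⟨U, hU⟩ : ∃ U : ℝ → ℝ, ∀ s, U s = Polynomial.aeval s u := ⟨_, fun _ => rfl⟩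
  obtain ⟨V, hV⟩ : ∃ V : ℝ → ℝ, ∀ s, V s = Polynomial.aeval s v := ⟨_, fun _ => rfl⟩
  simp only [← hU, ← hV] at hv0 hmono htest ⊢
  have hU_cont : Continuous U := by
    rw [show U = fun s => Polynomial.aeval s u from funext hU]
    exact Polynomial.continuous_aeval u
  have hV_cont : Continuous V := by
    rw [show V = fun s => Polynomial.aeval s v from funext hV]
    exact Polynomial.continuous_aeval v
  have hW_cont : Continuous fun s => U s + V s := hU_cont.add hV_cont
  have h11 : (1 : ℝ) ∈ Icc (0 : ℝ) 1 := right_mem_Icc.2 zero_le_one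
  obtain ⟨e, he_cont, -, he_mem, he_W, -, he_iff⟩ := exists_extendedInverse hW_cont hmono
  -- the regularised slope `Vc = V ∘ projIcc 0 1`: continuous, positive, `= V` on `[0,1]`
  obtain ⟨Vc, hVc_def⟩ : ∃ Vc : ℝ → ℝ, Vc = fun σ => V (Set.projIcc (0 : ℝ) 1 zero_le_one σ) :=
    ⟨_, rfl⟩
  have hVc_cont : Continuous Vc := by
    rw [hVc_def]
    exact hV_cont.comp (continuous_subtype_val.comp continuous_projIcc)
  have hVc_pos : ∀ σ, 0 < Vc σ := fun σ => by
    rw [hVc_def]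
    exact hv0 _ (Set.projIcc (0 : ℝ) 1 zero_le_one σ).2
  have hVc_eq : ∀ σ ∈ Icc (0 : ℝ) 1, Vc σ = V σ := fun σ hσ => by
    rw [hVc_def]
    show V (Set.projIcc (0 : ℝ) 1 zero_le_one σ) = V σ
    rw [Set.projIcc_of_mem _ hσ]
  -- extrema of `U` on `[0,1]`: `U σ₀ = min U` (so `T > U σ₀`), `U σ₁ = max U`
  obtain ⟨σ₀, -, hmin⟩ :=
    isCompact_Icc.exists_isMinOn (nonempty_Icc.2 zero_le_one) hU_cont.continuousOn
  obtain ⟨σ₁, hσ₁, hmax⟩ :=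
    isCompact_Icc.exists_isMaxOn (nonempty_Icc.2 zero_le_one) hU_cont.continuousOn
  rw [isMinOn_iff] at hmin
  rw [isMaxOn_iff] at hmax
  -- the density integrand `ψ y σ = P((y − U σ)/Vc σ, σ)/Vc σ`, continuous on `ℝ²`
  obtain ⟨ψ, hψ_def⟩ : ∃ ψ : ℝ → ℝ → ℝ, ψ = fun y σ => aeval ![(y - U σ) / Vc σ, σ] P / Vc σ :=
    ⟨_, rfl⟩
  have hψ_cont : Continuous (Function.uncurry ψ) := by
    rw [hψ_def]
    have h1 : Continuous fun p : ℝ × ℝ => Vc p.2 := hVc_cont.comp continuous_snd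
    exact ((continuous_aeval_real P).comp (continuous_vec_two
      ((continuous_fst.sub (hU_cont.comp continuous_snd)).div h1 fun p => (hVc_pos p.2).ne')
      continuous_snd)).div h1 fun p => (hVc_pos p.2).ne'
  -- the top-interval density `Φt y = ∫_{e y}^{1} ψ y σ dσ`, continuous on `ℝ`
  obtain ⟨Φt, hΦt_def⟩ : ∃ Φt : ℝ → ℝ, Φt = fun y => ∫ σ in e y..1, ψ y σ := ⟨_, rfl⟩
  have hΦt_cont : Continuous Φt := by
    rw [hΦt_def]
    exact continuous_parametric_intervalIntegral_left hψ_cont he_cont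
  -- the full density `Φ y = ∫_{σ ∈ (0,1)} 𝟙[U σ < y < U σ + Vc σ] ψ y σ dσ` of `T_*(P dz)`
  obtain ⟨S, hS_def⟩ : ∃ S : ℝ → Set ℝ, S = fun y => {σ | U σ < y} ∩ {σ | y < U σ + Vc σ} :=
    ⟨_, rfl⟩
  have hS_meas : ∀ y, MeasurableSet (S y) := fun y => by
    rw [hS_def]
    show MeasurableSet ({σ | U σ < y} ∩ {σ | y < U σ + Vc σ})
    exact (measurableSet_lt hU_cont.measurable measurable_const).inter
      (measurableSet_lt measurable_const (hU_cont.measurable.add hVc_cont.measurable))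
  obtain ⟨Φ, hΦ_def⟩ : ∃ Φ : ℝ → ℝ, Φ = fun y => ∫ σ in Ioo (0 : ℝ) 1, (S y).indicator (ψ y) σ :=
    ⟨_, rfl⟩
  -- (1) continuous test functions: `T` takes values in `[U σ₀, W 1]` on the open square
  have hTAB : ∀ z ∈ Set.pi Set.univ (fun _ : Fin 2 => Ioo (0 : ℝ) 1),
      U (z 1) + V (z 1) * z 0 ∈ Icc (U σ₀) (U 1 + V 1) := fun z hz => by
    have hz0 : z 0 ∈ Ioo (0 : ℝ) 1 := Set.mem_univ_pi.1 hz 0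
    have hz1 : z 1 ∈ Icc (0 : ℝ) 1 := Ioo_subset_Icc_self (Set.mem_univ_pi.1 hz 1)
    have hV1 : 0 < V (z 1) := hv0 _ hz1
    have hW1 : U (z 1) + V (z 1) ≤ U 1 + V 1 := hmono.monotoneOn hz1 h11 hz1.2
    exact ⟨by linarith [hmin (z 1) hz1, mul_pos hV1 hz0.1],
      by linarith [mul_le_of_le_one_right hV1.le hz0.2.le]⟩
  have htest' : ∀ φ : ℝ → ℝ, Continuous φ →
      ∫ z in Set.pi Set.univ (fun _ : Fin 2 => Ioo (0 : ℝ) 1),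
        φ (U (z 1) + V (z 1) * z 0) * aeval z P = 0 := fun φ hφ =>
    setIntegral_comp_mul_aeval_eq_zero P (T := fun z => U (z 1) + V (z 1) * z 0)
      ((hU_cont.comp (continuous_apply 1)).add
        ((hV_cont.comp (continuous_apply 1)).mul (continuous_apply 0))) hTAB htest hφ
  -- (2) `∫_□ φ(T) P = ∫ φ Φ = 0` for continuous `φ`: substitution and Fubini
  have horth : ∀ φ : ℝ → ℝ, Continuous φ →
      ∫ y in Ioo (U σ₀) (U 1 + V 1), φ y * Φ y = 0 := by
    intro φ hφ
    -- (i) the square integral as an iterated integral, `σ = z 1` outside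
    have h1 : ∫ σ in Ioo (0 : ℝ) 1, ∫ x in Ioo (0 : ℝ) 1,
        φ (U σ + V σ * x) * aeval ![x, σ] P = 0 := by
      have h := htest' φ hφ
      rw [setIntegral_pi_Ioo_fin_two] at h
      simp only [Matrix.cons_val_zero, Matrix.cons_val_one] at h
      have hGc : Continuous fun p : ℝ × ℝ => φ (U p.2 + V p.2 * p.1) * aeval ![p.1, p.2] P :=
        (hφ.comp ((hU_cont.comp continuous_snd).add
          ((hV_cont.comp continuous_snd).mul continuous_fst))).mul
          ((continuous_aeval_real P).comp (continuous_vec_two continuous_fst continuous_snd))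
      rwa [setIntegral_Ioo_prod_Ioo_symm _ hGc] at h
    -- the integrand after the substitution `y = U σ + V σ · x` and zero-extension in `y`
    obtain ⟨F, hF_def⟩ : ∃ F : ℝ × ℝ → ℝ, F = ({p : ℝ × ℝ | U p.1 < p.2} ∩
        {p | p.2 < U p.1 + Vc p.1}).indicator (fun p => φ p.2 * ψ p.2 p.1) := ⟨_, rfl⟩
    -- (ii) substitution in the inner integral
    have h2 : ∫ σ in Ioo (0 : ℝ) 1, ∫ y in Ioo (U σ₀) (U 1 + V 1), F (σ, y) = 0 := by
      refine Eq.trans (setIntegral_congr_fun measurableSet_Ioo fun σ hσ => ?_) h1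
      have hσ' : σ ∈ Icc (0 : ℝ) 1 := Ioo_subset_Icc_self hσ
      have hVσ : 0 < V σ := hv0 σ hσ'
      have hcB : U σ + V σ ≤ U 1 + V 1 := hmono.monotoneOn hσ' h11 hσ'.2
      rw [setIntegral_Ioo_unit_comp_affine (fun x => φ (U σ + V σ * x) * aeval ![x, σ] P) hVσ
        (U σ) (hmin σ hσ') hcB]
      refine setIntegral_congr_fun measurableSet_Ioo fun y _ => ?_
      have hy' : U σ + V σ * ((y - U σ) / V σ) = y := by field_simp; ring
      simp only [hF_def, hψ_def, Set.indicator_apply, mem_inter_iff, mem_setOf_eq, mem_Ioo, hy',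
        hVc_eq σ hσ']
      split_ifs <;> ring
    -- (iii) Fubini
    have hF_int : IntegrableOn F (Ioo (0 : ℝ) 1 ×ˢ Ioo (U σ₀) (U 1 + V 1)) volume := by
      rw [hF_def]
      refine Integrable.indicator ?_
        ((measurableSet_lt (hU_cont.measurable.comp measurable_fst) measurable_snd).inter
          (measurableSet_lt measurable_snd ((hU_cont.measurable.comp measurable_fst).add
            (hVc_cont.measurable.comp measurable_fst))))
      have hGc : Continuous fun p : ℝ × ℝ => φ p.2 * ψ p.2 p.1 :=
        (hφ.comp continuous_snd).mul (hψ_cont.comp (continuous_snd.prodMk continuous_fst))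
      exact (hGc.continuousOn.integrableOn_compact (isCompact_Icc.prod isCompact_Icc)).mono_set
        (Set.prod_mono Ioo_subset_Icc_self Ioo_subset_Icc_self)
    have h3 : ∫ y in Ioo (U σ₀) (U 1 + V 1), ∫ σ in Ioo (0 : ℝ) 1, F (σ, y) = 0 := by
      rw [← setIntegral_setIntegral_swap F hF_int]
      exact h2
    -- (iv) the inner integral is `φ y · Φ y`
    refine Eq.trans (setIntegral_congr_fun measurableSet_Ioo fun y _ => ?_) h3
    have hind : ∀ σ, F (σ, y) = φ y * (S y).indicator (ψ y) σ := fun σ => by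
      simp only [hF_def, hS_def, Set.indicator_apply, mem_inter_iff, mem_setOf_eq, mul_ite,
        mul_zero]
    simp_rw [hind]
    rw [integral_const_mul, hΦ_def]
  -- (3) above `max U` the density is the top-interval one
  have hΦJ : ∀ y, U σ₁ < y → Φ y = Φt y := fun y hy => by
    have hset : Ioo (0 : ℝ) 1 ∩ S y = Ioo (e y) 1 := by
      ext σ
      simp only [hS_def, mem_inter_iff, mem_setOf_eq]
      constructor
      · rintro ⟨hσ, -, hlt'⟩
        rw [hVc_eq σ (Ioo_subset_Icc_self hσ)] at hlt'
        exact ⟨((he_iff σ hσ y).2).1 hlt', hσ.2⟩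
      · rintro ⟨hl, hr⟩
        have hσ : σ ∈ Ioo (0 : ℝ) 1 := ⟨(he_mem y).1.trans_lt hl, hr⟩
        refine ⟨hσ, (hmax σ (Ioo_subset_Icc_self hσ)).trans_lt hy, ?_⟩
        rw [hVc_eq σ (Ioo_subset_Icc_self hσ)]
        exact ((he_iff σ hσ y).2).2 hl
    rw [hΦ_def, hΦt_def]
    show ∫ σ in Ioo (0 : ℝ) 1, (S y).indicator (ψ y) σ = ∫ σ in e y..1, ψ y σ
    rw [setIntegral_indicator (hS_meas y), hset, intervalIntegral.integral_of_le (he_mem y).2,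
      integral_Ioc_eq_integral_Ioo]
  -- (4) `Φt` is zero a.e. on `J = (max U, W 1)`, hence everywhere on `J` by continuity
  have hJ : Ioo (U σ₁) (U 1 + V 1) ⊆ Ioo (U σ₀) (U 1 + V 1) :=
    Ioo_subset_Ioo_left (hmin σ₁ hσ₁)
  have hae : ∀ᵐ y ∂(volume : Measure ℝ), y ∈ Ioo (U σ₁) (U 1 + V 1) → Φt y = 0 := by
    refine isOpen_Ioo.ae_eq_zero_of_integral_contDiff_smul_eq_zero
      (hΦt_cont.locallyIntegrable.locallyIntegrableOn _) fun g hg _ hgJ => ?_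
    have hg0 : ∀ y, y ∉ Ioo (U σ₁) (U 1 + V 1) → g y = 0 := fun y hy =>
      image_eq_zero_of_notMem_tsupport fun h => hy (hgJ h)
    have hpt : (fun y => g y • Φt y) = fun y => g y * Φ y := by
      funext y
      rw [smul_eq_mul]
      by_cases hy : y ∈ Ioo (U σ₁) (U 1 + V 1)
      · rw [hΦJ y hy.1]
      · rw [hg0 y hy, zero_mul, zero_mul]
    rw [hpt, ← setIntegral_eq_integral_of_forall_compl_eq_zero (s := Ioo (U σ₀) (U 1 + V 1))
      fun y hy => mul_eq_zero_of_left (hg0 y fun h => hy (hJ h)) (Φ y)]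
    exact horth g hg.continuous
  have hzero : EqOn Φt 0 (Ioo (U σ₁) (U 1 + V 1)) :=
    Measure.eqOn_open_of_ae_eq ((ae_restrict_iff' measurableSet_Ioo).2 hae) isOpen_Ioo
      hΦt_cont.continuousOn continuous_zero.continuousOn
  -- (5) evaluate at `y = W s ∈ J`, where `e (W s) = s`
  intro s hs hlt
  have hs' : s ∈ Icc (0 : ℝ) 1 := Ioo_subset_Icc_self hs
  have h0 : Φt (U s + V s) = 0 := hzero ⟨hlt σ₁ hσ₁, hmono hs' h11 hs.2⟩
  rw [hΦt_def] at h0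
  simp only at h0
  rw [he_W s hs', intervalIntegral.integral_of_le hs.2.le, integral_Ioc_eq_integral_Ioo,
    hψ_def] at h0
  refine Eq.trans (setIntegral_congr_fun measurableSet_Ioo fun σ hσ => ?_) h0
  simp only [hVc_eq σ ⟨hs.1.le.trans hσ.1.le, hσ.2.le⟩]

end Summit.KontsevichZagierPeriods.InverseLandau.TateFamilyKernel.Descent

end
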